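import Summits.QuantumFields.YangMills.Theorems.BalabanUVNodesN15NeumannCubeLiftConvolution
import HarnessLib

/-!
# Route «BalabanUVNodes» (K3⁷), node N15 = NE2, -a lane, PROGRAMME P file P-IIg: LIFTED IMAGES CONVOLUTIONS AND THE UNCUT TWO-LATTICE LIFT —
# the two lemmas behind the η-defect of the lifted cube propagator for big-torus operators that do NOT descend (dag-n15-c WANT-n15-a (g12-3), part 1 of 2)

Cell `pub-ymgap`, seat `pub-ymgap-dag-n15-a` (KNIT-BY-NAME, g21; D-0062; chair R424 venue; `bears_on: R4∕N15`); `--kind proof --supports stmt-QuantumFields-20544 --as helper`.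
Sequel of P-IIe `…NeumannCubeLiftConvolution` ((β′): ONE big-torus operator behind the lift; `conv_exp_torRed_le`, `hasMaj_liftCubeG_images`, `hasMaj_pull_restrict_of_blockMap`) and P-IIc
`…NeumannCubeLiftDefect` (King's pairing commutes with `π`: `kingPrV_redBond`, `kingPrV_mem_cubeW_iff`, `kingPrV_not_mem_image`, `restrictOp_comp_pull_of_compl`).  Used by P-IIh
`…NeumannCubeLiftConvolutionDefect` (THE ROW of dag-n15-c g12 I.31476 WANT-n15-a (g12-3): N-IIk `hasMaj_idef_chiCube_comp_neumannCubeG_of` LIFTED to the torus of record for NON-descending `T₁`).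

WHAT.  Torus pair `π : Tor M → Tor M′` (`M′_ν ∣ M_ν`; `M′_ν = 2S` where said), cube `□ + c` of side `S`, King's prolongation `P = pull (kingPrV L k r M)` on the BIG torus, `P̃ = pull (kingPrV L k r M′)` on
the small one (spacings `L^k ⊂ L^r·L^k`), `𝔇(A′, A) := A′∘P − P∘A`, `X^{↑} = liftOp = π^* ∘ X′ ∘ ρ` (P-IIb).
§33 LIFTED IMAGES CONVOLUTIONS (any source∕target norm, any intermediate spacing `n`): ★ `hasMaj_comp_of_liftImage` — ONE bump at a `π`-read mirror image `A(y′)·B·e^{−δ₀|refl′_T(πy″) − πy′|′}`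
behind a BIG-torus operator `T₁ ≤ a₁e^{−ρ₁|·|_T}` (it need NOT descend) gives `A(y′)·a₁Bc_r·e^{−ρ|πy − refl′_T(πy′)|′}`: the big torus's row sum eats the periodic repetitions (P-IIe
`conv_exp_torRed_le`); ★ `hasMaj_comp_of_liftImages` (the `2^{d+1}` images at once — the computation of P-IIe `hasMaj_comp_liftCubeG_images` for ANY `W`); ★ `hasMaj_chiCube_comp_of_liftImage` ∕
★★ `hasMaj_chiCube_comp_of_liftImages` — behind the output cut `χ_□` a `π`-read image bump is a two-sided letter `1_□(y)1_□(y′)·B·e^{−ρ|y−y′|_T}` (`2^{d+1}B` for the images kernel): on the cube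
torus the images are farther (N-IIIb `tdistT_le_tdistT_reflBlk`) and `|πy − πy′|′ = |y − y′|_T` on the cube (P-IIa `tdistT_torRed_eq`).
§34 THE UNCUT TWO-LATTICE LIFT: `pullVR_apply_redBond`; ★ `pull_kingPrV_comp_pullVR` (`P ∘ π^* = π′^* ∘ P̃`: KING's PROLONGATION COMMUTES WITH THE PERIODISATION); ★ `restrictOp_comp_pull_kingPrV`
(`ρ′ ∘ P = P̃ ∘ ρ`: … AND WITH THE WINDOW RESTRICTION — P-IIc's four compatibilities discharged); ★★ `idef_liftOp` — `𝔇(X₂′^{↑}, X₁′^{↑}) = π′^* ∘ 𝔇̃(X₂′, X₁′) ∘ ρ` EXACTLY for ANY small-torus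
operators at the two spacings (the UNCUT companion of P-IIc `idef_transplant_eq_extend_comp_restrict`); `idef_liftCubeG`; ★★ `hasMaj_pull_comp_restrict_of_blockMap₂` — THE TWO-TYPE UNCUT
TRANSFER LEMMA (`Pl ∘ T′ ∘ ρ_{W₁}` has the small letter read through the block map, source-localized at the window, for EVERY output block; two-type form of P-IIe's master lemma); ★★
`hasMaj_pullVR_comp_restrict` (its torus-pair instance: `π₂^* ∘ Y ∘ ρ₁ ≤ 1_□(y′)·K′(πy, πy′)` for `Y ≤ K′` between two spacings of the cube torus).
HONEST FRAMING.  Block-majorant bookkeeping (King's pairing through `ZMod.castHom`, method of images read through `π`, one mixed row-sum convolution per image); no new analytic estimate;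
`U ≡ 1` torus MODEL of [B5] §1; [B6]'s printed road for `G(□)` is the random-walk expansion (2.91)–(2.93) on `T_□` — here only the kinematics of `T_□ → T` is used; nothing of [B6] (2.38)–(2.40) ∕
[B9] Thm 3.14 asserted; N15 NOT discharged (object-bound; NE2⁺ NOT PRINTED); counts UNMOVED (typed 28∕28 · discharged 5∕27); finite tori per index — NOT continuum ∕ ℝ⁴ ∕ OS ∕ mass gap ∕ Clay.
Theorems only (0 def); every theorem is [folklore] lattice algebra ∕ bookkeeping about printed objects.
-/

noncomputable section

open scoped BigOperators Matrix
open Finset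

namespace Summit.QuantumFields.YangMills.BalabanUVNodes.N15.TwoGrid

open Literature.MathematicalPhysics.QuantumFieldTheory.Balaban1983to89
open Literature.MathematicalPhysics.QuantumFieldTheory.Balaban1983to89.B5Prop11Plancherel (Tor fine unitVec)
open Literature.MathematicalPhysics.QuantumFieldTheory.Balaban1983to89.B5SiteBridgeP12 (MP)
open Literature.MathematicalPhysics.QuantumFieldTheory.Balaban1983to89.B6Prop26Gluing (mulOp mulOp_apply ind ind_nonneg ind_le_one)
open Literature.MathematicalPhysics.QuantumFieldTheory.Balaban1983to89.B6Prop26ReachTransplant (restrictOp restrictOp_apply restrictOp_apply_of_injOn restrictOp_apply_of_not_mem)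
open Literature.MathematicalPhysics.QuantumFieldTheory.King1986.Torus (blockOf tdistT tdistT_symm tdistT_nonneg)
open Literature.MathematicalPhysics.QuantumFieldTheory.Balaban1983to89.B11SectG (BlockNorm HasMaj RowSum hasMaj_comp)
open Literature.MathematicalPhysics.QuantumFieldTheory.Balaban1983to89.B11AxialTransport190 (abs_le_loc_ofBlocks loc_ofBlocks_le)
open Literature.MathematicalPhysics.QuantumFieldTheory.Balaban1983to89.B6RandomWalk (Triangle254)
open Literature.MathematicalPhysics.QuantumFieldTheory.Balaban1983to89.B6UnitTorusCarrier (unitTorusGeo)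
open Literature.MathematicalPhysics.QuantumFieldTheory.Balaban1983to89.T4EtaRateDefect (idef idef_comp)
open Literature.MathematicalPhysics.QuantumFieldTheory.Balaban1983to89.T4EtaRateCoeffDefect (pull pull_apply)
open Summit.QuantumFields.YangMills.BalabanUVNodes.N15.VectorPiece (kingPr kingPrV kingPrV_eq blkFine blkFine_comp_kingPrV)

variable {d : ℕ}

/-! ## §33 Lifted images convolutions: a bump at a `π`-read mirror image behind a big-torus operator; behind the output cut it is two-sided -/

section LiftImages

variable {L : ℕ} (n : ℕ) [NeZero n] {M M' : Fin (d + 1) → ℕ} [∀ μ, NeZero (M μ)] [∀ μ, NeZero (M' μ)] (hM : ∀ μ, M' μ ∣ M μ) (c : Tor M) (S : ℕ) {k : ℕ}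

/-- ★ **ONE BUMP AT A `π`-READ MIRROR IMAGE SURVIVES ONE BIG-TORUS CONVOLUTION** (any source norm `b₁`, any target norm `b₃`, any intermediate spacing `n`): if
`W ≤ A(y′)·B·e^{−δ₀|refl′_T(πy″) − πy′|′}` (a bump centred at the `T`-image, on the cube torus, of the source block) and `T₁ ≤ a₁e^{−ρ₁|·|_T}` on the BIG torus (it need NOT descend), then
`T₁ ∘ W ≤ A(y′)·a₁Bc_r·e^{−ρ|πy − refl′_T(πy′)|′}` (`c_r` the big torus's row sum at `σ`, `ρ ≤ δ₀`, `ρ + σ ≤ ρ₁`): the row sum eats the periodic repetitions (P-IIe `conv_exp_torRed_le`).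
[cite: Balaban1984PropagatorsII, (2.37) p.229 (images), Lemma 2.1 (2.61)–(2.62) p.234 (row sums), (2.90)–(2.91) p.239 (T_□ read on the big lattice)] -/
theorem hasMaj_comp_of_liftImage {F₁ F₃ : Type} [AddCommGroup F₁] [Module ℝ F₁] [AddCommGroup F₃] [Module ℝ F₃] {b₁ : BlockNorm (unitTorusGeo L k M) F₁}
    {b₃ : BlockNorm (unitTorusGeo L k M) F₃} {W : F₁ →ₗ[ℝ] (Tor (fine n M) × Fin (d + 1) → ℝ)} {T₁ : (Tor (fine n M) × Fin (d + 1) → ℝ) →ₗ[ℝ] F₃} {A : Tor M → ℝ}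
    {B a₁ δ₀ ρ₁ ρ σ cr : ℝ} (htri' : Triangle254 (unitTorusGeo L k M')) (hrow : RowSum (unitTorusGeo L k M) σ cr) (hA : ∀ y', 0 ≤ A y') (hB : 0 ≤ B) (ha₁ : 0 ≤ a₁) (hρ : 0 ≤ ρ)
    (hρδ : ρ ≤ δ₀) (hρσ : ρ + σ ≤ ρ₁) (T : Finset (Fin (d + 1)))
    (h₁ : HasMaj (BlockNorm.ofBlocks (unitTorusGeo L k M) (fun b : Tor (fine n M) × Fin (d + 1) => blockOf n M b.1)) b₃ T₁ (fun y y' => a₁ * Real.exp (-(ρ₁ * tdistT M y y'))))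
    (hW : HasMaj b₁ (BlockNorm.ofBlocks (unitTorusGeo L k M) (fun b : Tor (fine n M) × Fin (d + 1) => blockOf n M b.1)) W
      (fun y y' => A y' * (B * Real.exp (-(δ₀ * tdistT M' (reflBlk M' (torRed hM c) T (torRed hM y)) (torRed hM y')))))) :
    HasMaj b₁ b₃ (T₁ ∘ₗ W) (fun y y' => A y' * (a₁ * B * cr * Real.exp (-(ρ * tdistT M' (torRed hM y) (reflBlk M' (torRed hM c) T (torRed hM y')))))) := by
  have hcr : 0 ≤ cr := hrow.nonneg c
  refine (hasMaj_comp h₁ hW fun y y' => mul_nonneg ha₁ (Real.exp_nonneg _)).mono fun y y' => ?_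
  dsimp only
  have hκ : (BlockNorm.ofBlocks (unitTorusGeo L k M) (fun b : Tor (fine n M) × Fin (d + 1) => blockOf n M b.1)).κ = 1 := rfl
  have hconv := conv_exp_torRed_le hM htri' hrow hρ hρδ hρσ y (reflBlk M' (torRed hM c) T (torRed hM y'))
  calc ∑ z : Tor M, a₁ * Real.exp (-(ρ₁ * tdistT M y z)) *
        ((BlockNorm.ofBlocks (unitTorusGeo L k M) (fun b : Tor (fine n M) × Fin (d + 1) => blockOf n M b.1)).κ *
          (A y' * (B * Real.exp (-(δ₀ * tdistT M' (reflBlk M' (torRed hM c) T (torRed hM z)) (torRed hM y'))))))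
      = A y' * (a₁ * B) * ∑ z : Tor M, Real.exp (-(ρ₁ * tdistT M y z)) * Real.exp (-(δ₀ * tdistT M' (torRed hM z) (reflBlk M' (torRed hM c) T (torRed hM y')))) := by
        rw [hκ, Finset.mul_sum]; exact Finset.sum_congr rfl fun z _ => by rw [tdistT_reflBlk_comm]; ring
    _ ≤ A y' * (a₁ * B) * (cr * Real.exp (-(ρ * tdistT M' (torRed hM y) (reflBlk M' (torRed hM c) T (torRed hM y'))))) :=
        mul_le_mul_of_nonneg_left hconv (mul_nonneg (hA y') (mul_nonneg ha₁ hB))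
    _ = _ := by ring

/-- ★ **THE `2^{d+1}` `π`-READ IMAGES AT ONCE**: if `W ≤ A(y′)·B·Σ_T e^{−δ₀|refl′_T(πy″) − πy′|′}` and `T₁ ≤ a₁e^{−ρ₁|·|_T}` on the BIG torus, then
`T₁ ∘ W ≤ A(y′)·a₁Bc_r·Σ_T e^{−ρ|πy − refl′_T(πy′)|′}` (the computation of P-IIe `hasMaj_comp_liftCubeG_images`, any `W`).
[cite: Balaban1984PropagatorsII, (2.37) p.229, Lemma 2.1 (2.61)–(2.62) p.234, (2.90)–(2.91) p.239] -/
theorem hasMaj_comp_of_liftImages {F₁ F₃ : Type} [AddCommGroup F₁] [Module ℝ F₁] [AddCommGroup F₃] [Module ℝ F₃] {b₁ : BlockNorm (unitTorusGeo L k M) F₁}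
    {b₃ : BlockNorm (unitTorusGeo L k M) F₃} {W : F₁ →ₗ[ℝ] (Tor (fine n M) × Fin (d + 1) → ℝ)} {T₁ : (Tor (fine n M) × Fin (d + 1) → ℝ) →ₗ[ℝ] F₃} {A : Tor M → ℝ}
    {B a₁ δ₀ ρ₁ ρ σ cr : ℝ} (htri' : Triangle254 (unitTorusGeo L k M')) (hrow : RowSum (unitTorusGeo L k M) σ cr) (hA : ∀ y', 0 ≤ A y') (hB : 0 ≤ B) (ha₁ : 0 ≤ a₁) (hρ : 0 ≤ ρ)
    (hρδ : ρ ≤ δ₀) (hρσ : ρ + σ ≤ ρ₁)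
    (h₁ : HasMaj (BlockNorm.ofBlocks (unitTorusGeo L k M) (fun b : Tor (fine n M) × Fin (d + 1) => blockOf n M b.1)) b₃ T₁ (fun y y' => a₁ * Real.exp (-(ρ₁ * tdistT M y y'))))
    (hW : HasMaj b₁ (BlockNorm.ofBlocks (unitTorusGeo L k M) (fun b : Tor (fine n M) × Fin (d + 1) => blockOf n M b.1)) W
      (fun y y' => A y' * (B * ∑ T ∈ (Finset.univ : Finset (Fin (d + 1))).powerset,
        Real.exp (-(δ₀ * tdistT M' (reflBlk M' (torRed hM c) T (torRed hM y)) (torRed hM y')))))) :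
    HasMaj b₁ b₃ (T₁ ∘ₗ W) (fun y y' => A y' * (a₁ * B * cr * ∑ T ∈ (Finset.univ : Finset (Fin (d + 1))).powerset,
      Real.exp (-(ρ * tdistT M' (torRed hM y) (reflBlk M' (torRed hM c) T (torRed hM y')))))) := by
  have hcr : 0 ≤ cr := hrow.nonneg c
  refine (hasMaj_comp h₁ hW fun y y' => mul_nonneg ha₁ (Real.exp_nonneg _)).mono fun y y' => ?_
  dsimp only
  have hκ : (BlockNorm.ofBlocks (unitTorusGeo L k M) (fun b : Tor (fine n M) × Fin (d + 1) => blockOf n M b.1)).κ = 1 := rfl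
  rw [hκ]
  have hper : ∀ T : Finset (Fin (d + 1)), ∑ z : Tor M, Real.exp (-(ρ₁ * tdistT M y z)) *
      Real.exp (-(δ₀ * tdistT M' (reflBlk M' (torRed hM c) T (torRed hM z)) (torRed hM y'))) ≤
        cr * Real.exp (-(ρ * tdistT M' (torRed hM y) (reflBlk M' (torRed hM c) T (torRed hM y')))) := by
    intro T
    have h := conv_exp_torRed_le hM htri' hrow hρ hρδ hρσ y (reflBlk M' (torRed hM c) T (torRed hM y'))
    refine le_trans (le_of_eq (Finset.sum_congr rfl fun z _ => ?_)) h
    rw [tdistT_reflBlk_comm]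
  calc ∑ z : Tor M, a₁ * Real.exp (-(ρ₁ * tdistT M y z)) * (1 * (A y' * (B *
          ∑ T ∈ (Finset.univ : Finset (Fin (d + 1))).powerset, Real.exp (-(δ₀ * tdistT M' (reflBlk M' (torRed hM c) T (torRed hM z)) (torRed hM y'))))))
      = ∑ z : Tor M, ∑ T ∈ (Finset.univ : Finset (Fin (d + 1))).powerset, A y' * (a₁ * B) *
          (Real.exp (-(ρ₁ * tdistT M y z)) * Real.exp (-(δ₀ * tdistT M' (reflBlk M' (torRed hM c) T (torRed hM z)) (torRed hM y')))) := by
        refine Finset.sum_congr rfl fun z _ => ?_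
        simp only [Finset.mul_sum]
        exact Finset.sum_congr rfl fun T _ => by ring
    _ = A y' * (a₁ * B) * ∑ T ∈ (Finset.univ : Finset (Fin (d + 1))).powerset,
          ∑ z : Tor M, Real.exp (-(ρ₁ * tdistT M y z)) * Real.exp (-(δ₀ * tdistT M' (reflBlk M' (torRed hM c) T (torRed hM z)) (torRed hM y'))) := by
        rw [Finset.sum_comm, Finset.mul_sum]
        exact Finset.sum_congr rfl fun T _ => by rw [Finset.mul_sum]
    _ ≤ A y' * (a₁ * B) * ∑ T ∈ (Finset.univ : Finset (Fin (d + 1))).powerset,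
          cr * Real.exp (-(ρ * tdistT M' (torRed hM y) (reflBlk M' (torRed hM c) T (torRed hM y')))) :=
        mul_le_mul_of_nonneg_left (Finset.sum_le_sum fun T _ => hper T) (mul_nonneg (hA y') (mul_nonneg ha₁ hB))
    _ = _ := by rw [← Finset.mul_sum]; ring

/-- ★ **BEHIND THE OUTPUT CUT ONE `π`-READ IMAGE BUMP IS A TWO-SIDED LETTER** (`M′_ν = 2S ∣ M_ν`): `W ≤ 1_□(y′)·B·e^{−ρ|πy − refl′_T(πy′)|′} ⟹ χ_□ ∘ W ≤ 1_□(y)1_□(y′)·B·e^{−ρ|y−y′|_T}` —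
on the cube torus the mirror image is farther than the block, and `|πy − πy′|′ = |y − y′|_T` on the cube (P-IIa `tdistT_torRed_eq`).
[cite: Balaban1984PropagatorsII, (2.37) p.229, (2.133)–(2.134) p.247 (shapes), p.238 (T_□)] -/
theorem hasMaj_chiCube_comp_of_liftImage (hM2 : ∀ ν, M' ν = 2 * S) {F₁ : Type} [AddCommGroup F₁] [Module ℝ F₁] {b₁ : BlockNorm (unitTorusGeo L k M) F₁}
    {W : F₁ →ₗ[ℝ] (Tor (fine n M) × Fin (d + 1) → ℝ)} {B ρ : ℝ} (hB : 0 ≤ B) (hρ : 0 ≤ ρ) (T : Finset (Fin (d + 1)))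
    (hW : HasMaj b₁ (BlockNorm.ofBlocks (unitTorusGeo L k M) (fun b : Tor (fine n M) × Fin (d + 1) => blockOf n M b.1)) W
      (fun y y' => ind (cubeBlocks M c S : Set (Tor M)) y' * (B * Real.exp (-(ρ * tdistT M' (torRed hM y) (reflBlk M' (torRed hM c) T (torRed hM y'))))))) :
    HasMaj b₁ (BlockNorm.ofBlocks (unitTorusGeo L k M) (fun b : Tor (fine n M) × Fin (d + 1) => blockOf n M b.1)) (mulOp (chiCube M n c S) ∘ₗ W)
      (fun y y' => ind (cubeBlocks M c S : Set (Tor M)) y * ind (cubeBlocks M c S : Set (Tor M)) y' * (B * Real.exp (-(ρ * tdistT M y y')))) := by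
  have hS2' : ∀ ν, 2 * S ≤ M' ν := fun ν => (hM2 ν).ge
  have hS2 : ∀ ν, 2 * S ≤ M ν := fun ν => (hS2' ν).trans (Nat.le_of_dvd (Nat.pos_of_ne_zero (NeZero.ne _)) (hM ν))
  have hS : ∀ ν, S ≤ M' ν := fun ν => by rw [hM2 ν]; omega
  have h := hasMaj_mulOp_chiCube_comp (c := c) (S := S) (fun y y' => mul_nonneg (ind_nonneg _ _) (mul_nonneg hB (Real.exp_nonneg _))) hW
  refine h.mono fun y y' => ?_
  by_cases hy : y ∈ cubeBlocks M c S
  · by_cases hy' : y' ∈ cubeBlocks M c S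
    · have hi : ind (cubeBlocks M c S : Set (Tor M)) y = 1 := by simp [ind, hy]
      have hi' : ind (cubeBlocks M c S : Set (Tor M)) y' = 1 := by simp [ind, hy']
      have hπy := torRed_mem_cubeBlocks (hM := hM) hS hy
      have hπy' := torRed_mem_cubeBlocks (hM := hM) hS hy'
      have heq := tdistT_torRed_eq (hM := hM) hS2 hS2' hy hy'
      have hle : Real.exp (-(ρ * tdistT M' (torRed hM y) (reflBlk M' (torRed hM c) T (torRed hM y')))) ≤ Real.exp (-(ρ * tdistT M y y')) :=
        Real.exp_le_exp.mpr (by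
          have := tdistT_le_tdistT_reflBlk (c := torRed hM c) hM2 hπy' hπy T
          rw [tdistT_symm M' (torRed hM y') (torRed hM y), heq, tdistT_symm M' (reflBlk M' (torRed hM c) T (torRed hM y')) (torRed hM y)] at this
          nlinarith)
      simp only [hi, hi', one_mul]
      exact mul_le_mul_of_nonneg_left hle hB
    · have hi' : ind (cubeBlocks M c S : Set (Tor M)) y' = 0 := by simp [ind, hy']
      rw [hi']; simp
  · have hi : ind (cubeBlocks M c S : Set (Tor M)) y = 0 := by simp [ind, hy]
    rw [hi]; simp

/-- ★★ **BEHIND THE OUTPUT CUT THE `π`-READ IMAGES KERNEL IS A TWO-SIDED LETTER** (`M′_ν = 2S ∣ M_ν`):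
`W ≤ 1_□(y′)·B·Σ_T e^{−ρ|πy − refl′_T(πy′)|′} ⟹ χ_□ ∘ W ≤ 1_□(y)1_□(y′)·2^{d+1}B·e^{−ρ|y−y′|_T}` (the `by_cases` of P-IIe `hasMaj_chiCube_comp_liftCubeG_of`, any `W`).
[cite: Balaban1984PropagatorsII, (2.37) p.229, (2.133)–(2.134) p.247 (shapes), p.238 (T_□)] -/
theorem hasMaj_chiCube_comp_of_liftImages (hM2 : ∀ ν, M' ν = 2 * S) {F₁ : Type} [AddCommGroup F₁] [Module ℝ F₁] {b₁ : BlockNorm (unitTorusGeo L k M) F₁}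
    {W : F₁ →ₗ[ℝ] (Tor (fine n M) × Fin (d + 1) → ℝ)} {B ρ : ℝ} (hB : 0 ≤ B) (hρ : 0 ≤ ρ)
    (hW : HasMaj b₁ (BlockNorm.ofBlocks (unitTorusGeo L k M) (fun b : Tor (fine n M) × Fin (d + 1) => blockOf n M b.1)) W
      (fun y y' => ind (cubeBlocks M c S : Set (Tor M)) y' * (B * ∑ T ∈ (Finset.univ : Finset (Fin (d + 1))).powerset,
        Real.exp (-(ρ * tdistT M' (torRed hM y) (reflBlk M' (torRed hM c) T (torRed hM y'))))))) :
    HasMaj b₁ (BlockNorm.ofBlocks (unitTorusGeo L k M) (fun b : Tor (fine n M) × Fin (d + 1) => blockOf n M b.1)) (mulOp (chiCube M n c S) ∘ₗ W)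
      (fun y y' => ind (cubeBlocks M c S : Set (Tor M)) y * ind (cubeBlocks M c S : Set (Tor M)) y' * (2 ^ (d + 1) * B * Real.exp (-(ρ * tdistT M y y')))) := by
  have hS2' : ∀ ν, 2 * S ≤ M' ν := fun ν => (hM2 ν).ge
  have hS2 : ∀ ν, 2 * S ≤ M ν := fun ν => (hS2' ν).trans (Nat.le_of_dvd (Nat.pos_of_ne_zero (NeZero.ne _)) (hM ν))
  have hS : ∀ ν, S ≤ M' ν := fun ν => by rw [hM2 ν]; omega
  have h := hasMaj_mulOp_chiCube_comp (c := c) (S := S) (fun y y' => mul_nonneg (ind_nonneg _ _) (mul_nonneg hB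
    (Finset.sum_nonneg fun _ _ => Real.exp_nonneg _))) hW
  refine h.mono fun y y' => ?_
  by_cases hy : y ∈ cubeBlocks M c S
  · by_cases hy' : y' ∈ cubeBlocks M c S
    · have hi : ind (cubeBlocks M c S : Set (Tor M)) y = 1 := by simp [ind, hy]
      have hi' : ind (cubeBlocks M c S : Set (Tor M)) y' = 1 := by simp [ind, hy']
      have hπy := torRed_mem_cubeBlocks (hM := hM) hS hy
      have hπy' := torRed_mem_cubeBlocks (hM := hM) hS hy'
      have heq := tdistT_torRed_eq (hM := hM) hS2 hS2' hy hy'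
      have hsumT : ∑ T ∈ (Finset.univ : Finset (Fin (d + 1))).powerset, Real.exp (-(ρ * tdistT M' (torRed hM y) (reflBlk M' (torRed hM c) T (torRed hM y')))) ≤
          2 ^ (d + 1) * Real.exp (-(ρ * tdistT M y y')) :=
        calc ∑ T ∈ (Finset.univ : Finset (Fin (d + 1))).powerset, Real.exp (-(ρ * tdistT M' (torRed hM y) (reflBlk M' (torRed hM c) T (torRed hM y'))))
            ≤ ∑ T ∈ (Finset.univ : Finset (Fin (d + 1))).powerset, Real.exp (-(ρ * tdistT M y y')) :=
              Finset.sum_le_sum fun T _ => Real.exp_le_exp.mpr (by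
                have := tdistT_le_tdistT_reflBlk (c := torRed hM c) hM2 hπy' hπy T
                rw [tdistT_symm M' (torRed hM y') (torRed hM y), heq, tdistT_symm M' (reflBlk M' (torRed hM c) T (torRed hM y')) (torRed hM y)] at this
                nlinarith)
          _ = 2 ^ (d + 1) * Real.exp (-(ρ * tdistT M y y')) := by
              rw [Finset.sum_const, Finset.card_powerset, Finset.card_univ, Fintype.card_fin, nsmul_eq_mul]; push_cast; ring
      simp only [hi, hi', one_mul]
      calc B * ∑ T ∈ (Finset.univ : Finset (Fin (d + 1))).powerset, Real.exp (-(ρ * tdistT M' (torRed hM y) (reflBlk M' (torRed hM c) T (torRed hM y'))))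
          ≤ B * (2 ^ (d + 1) * Real.exp (-(ρ * tdistT M y y'))) := mul_le_mul_of_nonneg_left hsumT hB
        _ = 2 ^ (d + 1) * B * Real.exp (-(ρ * tdistT M y y')) := by ring
    · have hi' : ind (cubeBlocks M c S : Set (Tor M)) y' = 0 := by simp [ind, hy']
      rw [hi']; simp
  · have hi : ind (cubeBlocks M c S : Set (Tor M)) y = 0 := by simp [ind, hy]
    rw [hi]; simp

end LiftImages

/-! ## §34 The uncut two-lattice lift: King's pairing commutes with `π` and with the window restriction; `𝔇(X₂′^{↑}, X₁′^{↑}) = π′^* ∘ 𝔇̃(X₂′, X₁′) ∘ ρ`; the two-type transfer -/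

section TwoLatticeLift

variable {L k r : ℕ} [NeZero L] {M M' : Fin (d + 1) → ℕ} [∀ μ, NeZero (M μ)] [∀ μ, NeZero (M' μ)] (hM : ∀ μ, M' μ ∣ M μ) (c : Tor M) (S : ℕ)

omit [NeZero L] [∀ μ, NeZero (M μ)] in
/-- `(π^*A)(b) = A(π̃ b)` on bonds (P-Ib `pullVR_apply` in the `redBond` syntax). [folklore] -/
theorem pullVR_apply_redBond (n : ℕ) [NeZero n] (A : Tor (fine n M') × Fin (d + 1) → ℝ) (b : Tor (fine n M) × Fin (d + 1)) : pullVR n hM A b = A (redBond n hM b) := by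
  obtain ⟨x, μ⟩ := b
  rw [pullVR_apply]; rfl

/-- ★ **KING's PROLONGATION COMMUTES WITH THE PERIODISATION**: `P ∘ π^* = π′^* ∘ P̃` (`P = pull (kingPrV L k r M)` on the big torus, `P̃` on the small one; P-IIc `kingPrV_redBond`).
[cite: King1986, p.664 (pairing convention); Balaban1984PropagatorsII, p.238 (T_□)] -/
theorem pull_kingPrV_comp_pullVR : pull (kingPrV L k r M) ∘ₗ pullVR (L ^ k) hM = pullVR (L ^ r * L ^ k) hM ∘ₗ pull (kingPrV L k r M') := by
  refine LinearMap.ext fun A => funext fun b => ?_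
  rw [LinearMap.comp_apply, LinearMap.comp_apply, pull_apply, pullVR_apply_redBond, pullVR_apply_redBond, pull_apply, kingPrV_redBond hM b]

/-- ★ **KING's PROLONGATION COMMUTES WITH THE WINDOW RESTRICTION**: `ρ′ ∘ P = P̃ ∘ ρ` (`ρ = restrictOp (cubeW n c S) (redBond n hM)` at the two spacings) — P-IIc `restrictOp_comp_pull_of_compl`
with its four compatibilities discharged (`kingPrV_mem_cubeW_iff`, `kingPrV_redBond`, `redBond_injOn_cubeW`, the complement condition `kingPrV_not_mem_image`); needs `S ≤ M′_ν`.
[cite: King1986, p.664; Balaban1984PropagatorsII, p.238 (T_□)] -/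
theorem restrictOp_comp_pull_kingPrV (hS : ∀ ν, S ≤ M' ν) :
    restrictOp (cubeW (L ^ r * L ^ k) c S) (redBond (L ^ r * L ^ k) hM) ∘ₗ pull (kingPrV L k r M) =
      pull (kingPrV L k r M') ∘ₗ restrictOp (cubeW (L ^ k) c S) (redBond (L ^ k) hM) :=
  restrictOp_comp_pull_of_compl (cubeW (L ^ k) c S) (redBond (L ^ k) hM) (cubeW (L ^ r * L ^ k) c S) (redBond (L ^ r * L ^ k) hM) (kingPrV L k r M) (kingPrV L k r M')
    (redBond_injOn_cubeW hS) (redBond_injOn_cubeW hS) (fun x₂ => (kingPrV_mem_cubeW_iff x₂).symm) (fun x₂ _ => (kingPrV_redBond hM x₂).symm)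
    (fun x₂' hx => kingPrV_not_mem_image hM x₂' hx)

/-- ★★ **THE η-DEFECT OF TWO UNCUT LIFTS IS THE UNCUT TWO-LATTICE LIFT OF THE SMALL DEFECT**: for ANY small-torus operators `X₁′` (spacing `L^k`) and `X₂′` (spacing `L^r·L^k`),
`𝔇_{P,P}(X₂′^{↑}, X₁′^{↑}) = π′^* ∘ 𝔇_{P̃,P̃}(X₂′, X₁′) ∘ ρ` EXACTLY (`X^{↑} = liftOp = π^* ∘ X′ ∘ ρ`; needs `S ≤ M′_ν`).
[cite: Balaban1985BackgroundPropagators, Thm 3.14 pp.426–427 (difference template), (3.42) p.397 (shape); Balaban1984PropagatorsII, p.238 (T_□), (2.90)–(2.91) p.239; King1986, p.664] -/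
theorem idef_liftOp (hS : ∀ ν, S ≤ M' ν) (X₁' : Module.End ℝ (Tor (fine (L ^ k) M') × Fin (d + 1) → ℝ)) (X₂' : Module.End ℝ (Tor (fine (L ^ r * L ^ k) M') × Fin (d + 1) → ℝ)) :
    idef (pull (kingPrV L k r M)) (pull (kingPrV L k r M)) (liftOp (L ^ r * L ^ k) hM c S X₂') (liftOp (L ^ k) hM c S X₁') =
      pullVR (L ^ r * L ^ k) hM ∘ₗ idef (pull (kingPrV L k r M')) (pull (kingPrV L k r M')) X₂' X₁' ∘ₗ restrictOp (cubeW (L ^ k) c S) (redBond (L ^ k) hM) := by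
  refine LinearMap.ext fun f => ?_
  have ha := LinearMap.congr_fun (pull_kingPrV_comp_pullVR (r := r) hM) (X₁' (restrictOp (cubeW (L ^ k) c S) (redBond (L ^ k) hM) f))
  have hb := LinearMap.congr_fun (restrictOp_comp_pull_kingPrV (r := r) hM c S hS) f
  simp only [LinearMap.comp_apply] at ha hb
  simp only [idef, liftOp, LinearMap.sub_apply, LinearMap.comp_apply, map_sub, hb, ha]

/-- `𝔇_{P,P}(G′^{↑}(□), G^{↑}(□)) = π′^* ∘ 𝔇_{P̃,P̃}(G′(□′), G(□′)) ∘ ρ` — the case `X′ = G(□′)` of `idef_liftOp`. [cite: Balaban1984PropagatorsII, p.238 (T_□), (2.90)–(2.91) p.239; King1986, p.664] -/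
theorem idef_liftCubeG (hS : ∀ ν, S ≤ M' ν) (a : ℝ) :
    idef (pull (kingPrV L k r M)) (pull (kingPrV L k r M)) (liftCubeG (L ^ r * L ^ k) hM c S a) (liftCubeG (L ^ k) hM c S a) =
      pullVR (L ^ r * L ^ k) hM ∘ₗ idef (pull (kingPrV L k r M')) (pull (kingPrV L k r M'))
        (neumannCubeG M' (L ^ r * L ^ k) (torRed hM c) S a) (neumannCubeG M' (L ^ k) (torRed hM c) S a) ∘ₗ restrictOp (cubeW (L ^ k) c S) (redBond (L ^ k) hM) := by
  rw [liftCubeG_eq_liftOp, liftCubeG_eq_liftOp, idef_liftOp hM c S hS]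

/-- ★★ **THE TWO-TYPE UNCUT TRANSFER LEMMA**: for a window `W₁ ⊆ X₁` mapped injectively by `e₁` into `X₁′`, an output chart `e₂ : X₂ → X₂′` with pull-back `Pl f = f ∘ e₂`, ONE map of blocks `σ`
with `blk₁′ ∘ e₁ = σ ∘ blk₁` on `W₁` and `blk₂′ ∘ e₂ = σ ∘ blk₂` EVERYWHERE, the window's blocks lying in `B`: an operator `T′ : (X₁′ → ℝ) → (X₂′ → ℝ)` with block letter `K′ ≥ 0` lifts to
`Pl ∘ T′ ∘ ρ_{W₁,e₁}` with letter `1_B(y′)·K′(σy, σy′)` for EVERY output block `y` (no output cut) — the two-type form of P-IIe `hasMaj_pull_restrict_of_blockMap`.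
[cite: Balaban1984PropagatorsII, (2.90)–(2.91) p.239 (operators of `T_□` read on the big lattice), (2.133) p.247 (shape)] -/
theorem hasMaj_pull_comp_restrict_of_blockMap₂ {X₁ X₂ X₁' X₂' : Type} [Fintype X₁] [Fintype X₂] [Fintype X₁'] [Fintype X₂'] [DecidableEq X₁'] {g g' : B6.Geometry}
    (W₁ : Finset X₁) (e₁ : X₁ → X₁') (e₂ : X₂ → X₂') (blk₁ : X₁ → g.Site) (blk₂ : X₂ → g.Site) (blk₁' : X₁' → g'.Site) (blk₂' : X₂' → g'.Site) (σ : g.Site → g'.Site) (B : Set g.Site)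
    (hblk₁ : ∀ x ∈ W₁, blk₁' (e₁ x) = σ (blk₁ x)) (hblk₂ : ∀ x, blk₂' (e₂ x) = σ (blk₂ x)) (hWB : ∀ x ∈ W₁, blk₁ x ∈ B) (hinj : Set.InjOn e₁ ↑W₁)
    {Pl : (X₂' → ℝ) →ₗ[ℝ] (X₂ → ℝ)} (hPl : ∀ f x, Pl f x = f (e₂ x)) {T' : (X₁' → ℝ) →ₗ[ℝ] (X₂' → ℝ)} {K' : g'.Site → g'.Site → ℝ} (hK' : ∀ a b, 0 ≤ K' a b)
    (hT : HasMaj (BlockNorm.ofBlocks g' blk₁') (BlockNorm.ofBlocks g' blk₂') T' K') :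
    HasMaj (BlockNorm.ofBlocks g blk₁) (BlockNorm.ofBlocks g blk₂) (Pl ∘ₗ T' ∘ₗ restrictOp W₁ e₁) (fun y y' => ind B y' * K' (σ y) (σ y')) := by
  classical
  intro y' μ hμ y
  dsimp only
  have hμ' : ∀ x, blk₁ x ≠ y' → μ x = 0 := hμ
  have hloc0 : 0 ≤ (BlockNorm.ofBlocks g blk₁).loc y' μ := (BlockNorm.ofBlocks g blk₁).loc_nonneg y' μ
  by_cases hy' : y' ∈ B
  swap
  · -- the window misses the block of `y′`: the restriction vanishes
    have hρ : restrictOp W₁ e₁ μ = 0 := by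
      funext x'
      rw [restrictOp_apply, Pi.zero_apply]
      refine Finset.sum_eq_zero fun x hx => ?_
      rw [Finset.mem_filter] at hx
      exact hμ' x fun hb => hy' (hb ▸ hWB x hx.1)
    have h0 : (Pl ∘ₗ T' ∘ₗ restrictOp W₁ e₁) μ = 0 := by rw [LinearMap.comp_apply, LinearMap.comp_apply, hρ, map_zero, map_zero]
    rw [h0, (BlockNorm.ofBlocks g blk₂).loc_zero]
    exact mul_nonneg (mul_nonneg (ind_nonneg _ _) (hK' _ _)) hloc0
  -- the restriction is localized at `σ y′` and no larger than `μ`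
  have hlocμ : (BlockNorm.ofBlocks g' blk₁').IsLoc (σ y') (restrictOp W₁ e₁ μ) := by
    intro x' hx'
    rw [restrictOp_apply]
    refine Finset.sum_eq_zero fun x hx => ?_
    rw [Finset.mem_filter] at hx
    by_contra hne
    have hb : blk₁ x = y' := by by_contra hb; exact hne (hμ' x hb)
    exact hx' (by rw [← hx.2, hblk₁ x hx.1, hb])
  have hle : (BlockNorm.ofBlocks g' blk₁').loc (σ y') (restrictOp W₁ e₁ μ) ≤ (BlockNorm.ofBlocks g blk₁).loc y' μ := by
    refine loc_ofBlocks_le blk₁' _ hloc0 fun x' _ => ?_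
    by_cases hex : ∃ x ∈ W₁, e₁ x = x' ∧ μ x ≠ 0
    · obtain ⟨x, hxW, hxe, hxμ⟩ := hex
      have hb : blk₁ x = y' := by by_contra hb; exact hxμ (hμ' x hb)
      rw [← hxe, restrictOp_apply_of_injOn hinj μ hxW]
      exact abs_le_loc_ofBlocks blk₁ μ hb
    · have h0 : restrictOp W₁ e₁ μ x' = 0 := by
        rw [restrictOp_apply]
        refine Finset.sum_eq_zero fun x hx => ?_
        rw [Finset.mem_filter] at hx
        by_contra hne
        exact hex ⟨x, hx.1, hx.2, hne⟩
      rw [h0, abs_zero]; exact (BlockNorm.ofBlocks g blk₁).loc_nonneg y' μ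
  have h1 := hT (σ y') (restrictOp W₁ e₁ μ) hlocμ (σ y)
  -- the output, read on the big lattice through the pull-back (NO cut: every block `y` is controlled by the small block `σ y`)
  have hout : (BlockNorm.ofBlocks g blk₂).loc y ((Pl ∘ₗ T' ∘ₗ restrictOp W₁ e₁) μ) ≤ (BlockNorm.ofBlocks g' blk₂').loc (σ y) (T' (restrictOp W₁ e₁ μ)) := by
    refine loc_ofBlocks_le blk₂ _ ((BlockNorm.ofBlocks g' blk₂').loc_nonneg _ _) fun x hx => ?_
    rw [LinearMap.comp_apply, LinearMap.comp_apply, hPl]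
    exact abs_le_loc_ofBlocks blk₂' _ (by rw [hblk₂ x, hx])
  rw [show ind B y' = 1 from by unfold ind; rw [if_pos hy'], one_mul]
  exact hout.trans (h1.trans (mul_le_mul_of_nonneg_left hle (hK' _ _)))

omit [NeZero L] in
/-- ★★ **THE UNCUT TWO-LATTICE LIFT ON THE TORUS PAIR** (`S ≤ M′_ν`, spacings `n₁`, `n₂`): if `Y ≤ K′` on the cube torus (blocks at `n₁` to blocks at `n₂`, `K′ ≥ 0`), then
`π_{n₂}^* ∘ Y ∘ ρ_{n₁} ≤ 1_□(y′)·K′(πy, πy′)` on the big torus, for EVERY output block. [cite: Balaban1984PropagatorsII, (2.90)–(2.91) p.239, p.238 (T_□)] -/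
theorem hasMaj_pullVR_comp_restrict (hS : ∀ ν, S ≤ M' ν) (n₁ n₂ : ℕ) [NeZero n₁] [NeZero n₂]
    {Y : (Tor (fine n₁ M') × Fin (d + 1) → ℝ) →ₗ[ℝ] (Tor (fine n₂ M') × Fin (d + 1) → ℝ)} {K' : Tor M' → Tor M' → ℝ} (hK' : ∀ a b, 0 ≤ K' a b)
    (hY : HasMaj (BlockNorm.ofBlocks (unitTorusGeo L k M') (fun b : Tor (fine n₁ M') × Fin (d + 1) => blockOf n₁ M' b.1))
      (BlockNorm.ofBlocks (unitTorusGeo L k M') (fun b : Tor (fine n₂ M') × Fin (d + 1) => blockOf n₂ M' b.1)) Y K') :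
    HasMaj (BlockNorm.ofBlocks (unitTorusGeo L k M) (fun b : Tor (fine n₁ M) × Fin (d + 1) => blockOf n₁ M b.1))
      (BlockNorm.ofBlocks (unitTorusGeo L k M) (fun b : Tor (fine n₂ M) × Fin (d + 1) => blockOf n₂ M b.1))
      (pullVR n₂ hM ∘ₗ Y ∘ₗ restrictOp (cubeW n₁ c S) (redBond n₁ hM)) (fun y y' => ind (cubeBlocks M c S : Set (Tor M)) y' * K' (torRed hM y) (torRed hM y')) :=
  hasMaj_pull_comp_restrict_of_blockMap₂ (g := unitTorusGeo L k M) (g' := unitTorusGeo L k M') (cubeW n₁ c S) (redBond n₁ hM) (redBond n₂ hM)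
    (fun b : Tor (fine n₁ M) × Fin (d + 1) => blockOf n₁ M b.1) (fun b : Tor (fine n₂ M) × Fin (d + 1) => blockOf n₂ M b.1)
    (fun b : Tor (fine n₁ M') × Fin (d + 1) => blockOf n₁ M' b.1) (fun b : Tor (fine n₂ M') × Fin (d + 1) => blockOf n₂ M' b.1) (torRed hM) (cubeBlocks M c S : Set (Tor M))
    (fun x _ => kingBlockOf_torRed (hM := hM) x.1) (fun x => kingBlockOf_torRed (hM := hM) x.1) (fun x hx => (mem_cubeW x).1 hx) (redBond_injOn_cubeW hS)
    (Pl := pullVR n₂ hM) (fun f x => pullVR_apply_redBond hM n₂ f x) hK' hY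

end TwoLatticeLift

end Summit.QuantumFields.YangMills.BalabanUVNodes.N15.TwoGrid
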